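/-
Copyright (c) 2026. All rights reserved.
Released under Apache 2.0 license as described in the file LICENSE.
Authors: abc-iut cell, prover seat abc-iut-f-102 (F fact-proving wave, gen 3), over abc-iut-L4-t5/L4-t12/L4-t15's toolkit.
-/
import Literature.AnabelianGeometry.AbsoluteAnabelian.DiagramLifts
import Literature.AnabelianGeometry.AbsoluteAnabelian.DiagramComap
import Literature.AnabelianGeometry.AbsoluteAnabelian.LogFrobeniusCorollaries
import HarnessLib

/-!
# [AbsTopIII] Cor 5.5 (i)/(iii): structure functors of the holomorphic part of `D•⊢` over `Th•[Z]`, and the induced homotopies (THEOREM B, toolkit 2/4)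

S. Mochizuki, *Topics in absolute anabelian geometry III: global reconstruction algorithms*,
J. Math. Sci. Univ. Tokyo 22 (2015) 939–1156 [MochizukiAbsTopIII2015]; locators `p.N` = pages of the author's
manuscript (`paper:url-5493eb38cbb7`), read on the page: Def 5.4 (ii) p. 125 ("`log•_{T,T}` lies over `Th•`"), (iv)
pp. 126–127 ("`λ⊞_{v,ν}` lies over `Th•[Z]`"), Cor 5.2 (iv)/(vii) p. 120 (the equivalences `ℰ• ≃ An•[𝒳] ≃ ℰ•`), Cor 5.5 (i)
p. 130 (the cores `ℰ•`, `An•[𝒳]`, `ℰ•` of rows 5, 6, 7), Rmk 3.5.1 p. 78 (a core as the "constant portion under the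
diagram"), Def 3.5 (ii) p. 75 (families of homotopies: identity, composition, whiskering).

PURPOSE (THEOREM B of the f-102 lineage: a family of homotopies on `D•⊢` realising Cor 5.5 (i)/(iii), from an
interface-level "over `Th•[Z]`" structure).  GIVEN, as free DATA (not the interface's own fields),
* `A v ν : λ⊞_{v,ν} ⋙ (𝒩⊞_v → 𝒩_v → ℰ•) ≅ proj` for every pre-log vertex `ν` of `Γ⃗^log_v` ("`λ⊞_{v,ν}` lies over `Th•[Z]`";
  the interface's instance is `lamOver`), and
* `Ξ : log ⋙ proj ≅ proj` ("`log` lies over `Th•`"; instance `logOver`),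
this file builds abc-iut-L4-t12's structure functors (`OverData`) on the HOLOMORPHIC full sub-diagram `D•` of `D•⊢` over
`ℰ• = Th•[Z]` THROUGH the fully faithful `T := κ_{An•} ⋙ κ₂ : ℰ• → An•[𝒳] → ℰ•` (so that the three core vertices `ℰ•`
(row 5) `↦ T`, `An•[𝒳] ↦ κ₂`, `ℰ•` (row 7) `↦ 𝟭` ALL carry fully faithful structure functors — abc-iut-L4-t15's device in
`cor55Cores_holds`), lifts paths of `Γ⃗_{D•⊢}` with holomorphic target into the sub-diagram (`DSub.liftPath`; the
sub-diagram IS the pulled-back diagram `incl^* D•⊢`, definitionally), and transports abc-iut-L4-t5's lifts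
(`OverData.lift`) to homotopies `coreLift p q : D•⊢_[p] ⟶ D•⊢_[q]` between ANY two co-verticial paths of `Γ⃗_{D•⊢}` into a
core vertex, with the four laws of Def 3.5 (ii) (`coreLift_self`, `_trans`, `_precomp_heq`, `_postcomp_heq`).  The
relative-lift datum of toolkit 3/4 combines these with the `ι⊞`-moves of toolkit 1/4.

Pure category-theoretic bookkeeping; `A`, `Ξ` are hypotheses-as-data; no claim of the paper is asserted.  Refereed
pre-IUT material; nothing here bears on [IUTchIII] Cor. 3.12; typed ≠ proved.
-/

set_option autoImplicit false

universe u

open CategoryTheory Quiver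

namespace Literature.AnabelianGeometry.AbsoluteAnabelian

variable {Vmod : Type u} {isArc : Vmod → Bool}

/-! ## Holomorphic vertices are closed under predecessors -/

namespace DVertex

/-- No arrow of `D•⊢` runs from the mono-analytic part `D⊢` back into `D•`: the source of an arrow with holomorphic
target is holomorphic. [cite: MochizukiAbsTopIII2015, Cor 5.10 p. 146] -/
theorem isHolomorphic_of_hom {a b : DVertex Vmod isArc} (e : a ⟶ b) (hb : b.IsHolomorphic) : a.IsHolomorphic := by
  cases e <;> trivial

/-- … hence so is the source of a path with holomorphic target. [cite: MochizukiAbsTopIII2015, Cor 5.10 p. 146] -/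
theorem isHolomorphic_of_path {a b : DVertex Vmod isArc} (p : Path a b) (hb : b.IsHolomorphic) : a.IsHolomorphic := by
  induction p with
  | nil => exact hb
  | cons p e ih => exact ih (isHolomorphic_of_hom e hb)

end DVertex

/-! ## Full sub-diagrams as pulled-back diagrams; lifting paths -/

namespace DSub

/-- The inclusion `Γ⃗_{D_{≤P}} ↪ Γ⃗_{D•⊢}` of the full sub-quiver on `P`. [cite: MochizukiAbsTopIII2015, Cor 5.5 p. 130] -/
def incl (P : DVertex Vmod isArc → Prop) : DSub P ⥤q DVertex Vmod isArc where
  obj a := a.1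
  map e := e

variable {P : DVertex Vmod isArc → Prop} (hcl : ∀ {a b : DVertex Vmod isArc}, (a ⟶ b) → P b → P a)

include hcl in
/-- For a predecessor-closed `P`, the source of a path into `P` lies in `P`. [cite: MochizukiAbsTopIII2015, Cor 5.5 p. 130] -/
theorem mem_of_path {a b : DVertex Vmod isArc} (p : Path a b) (hb : P b) : P a := by
  induction p with
  | nil => exact hb
  | cons p e ih => exact ih (hcl e hb)

/-- **Lifting a path of `Γ⃗_{D•⊢}` into the full sub-quiver** on a predecessor-closed `P` (same arrows).
[cite: MochizukiAbsTopIII2015, Cor 5.5 p. 130] -/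
def liftPath {a : DVertex Vmod isArc} :
    ∀ {b : DVertex Vmod isArc} (p : Path a b) (hb : P b),
      Path (V := DSub P) ⟨a, mem_of_path hcl p hb⟩ ⟨b, hb⟩
  | _, Path.nil, _ => Path.nil
  | _, Path.cons p e, hb => (liftPath p (hcl e hb)).cons e

/-- The lift maps back to the path. [cite: MochizukiAbsTopIII2015, Cor 5.5 p. 130] -/
theorem incl_mapPath_liftPath {a : DVertex Vmod isArc} :
    ∀ {b : DVertex Vmod isArc} (p : Path a b) (hb : P b), (incl P).mapPath (liftPath hcl p hb) = p
  | _, Path.nil, _ => rfl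
  | _, Path.cons p e, hb => by
    rw [liftPath, Prefunctor.mapPath_cons, incl_mapPath_liftPath p (hcl e hb)]
    rfl

/-- Lifting is compatible with composition of paths. [cite: MochizukiAbsTopIII2015, Cor 5.5 p. 130] -/
theorem liftPath_comp {a b : DVertex Vmod isArc} (p : Path a b) :
    ∀ {c : DVertex Vmod isArc} (q : Path b c) (hc : P c),
      liftPath hcl (p.comp q) hc = (liftPath hcl p (mem_of_path hcl q hc)).comp (liftPath hcl q hc)
  | _, Path.nil, _ => rfl
  | _, Path.cons q e, hc => by
    rw [Path.comp_cons, liftPath, liftPath, Path.comp_cons, liftPath_comp p q (hcl e hc)]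

end DSub

namespace LogFrobeniusSetting

variable (L : LogFrobeniusSetting Vmod isArc)

/-- The full sub-diagram `D_{≤P}` IS the diagram pulled back along the inclusion (abc-iut-L4-t5's `comapAlong`),
definitionally. [cite: MochizukiAbsTopIII2015, Definition 3.5 (i) p.74] -/
theorem subdiagram_eq_comapAlong (P : DVertex Vmod isArc → Prop) :
    L.subdiagram P = L.diagram.comapAlong (DSub.incl P) := rfl

/-- Hence the path functor of a lifted path is the path functor of the path.
[cite: MochizukiAbsTopIII2015, Definition 3.5 (i) p.75] -/
theorem pathFunctor_liftPath {P : DVertex Vmod isArc → Prop} (hcl : ∀ {a b : DVertex Vmod isArc}, (a ⟶ b) → P b → P a)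
    {a b : DVertex Vmod isArc} (p : Path a b) (hb : P b) :
    (L.subdiagram P).pathFunctor (DSub.liftPath hcl p hb) = L.diagram.pathFunctor p :=
  (L.diagram.pathFunctor_comapAlong (DSub.incl P) (DSub.liftPath hcl p hb)).trans
    (congrArg L.diagram.pathFunctor (DSub.incl_mapPath_liftPath hcl p hb))

/-! ## The structure functors of the holomorphic part over `ℰ•`, through `T = κ_{An•} ⋙ κ₂` -/

section OverE

variable (A : ∀ (v : Vmod) (ν : LogVertex (isArc v)), ν.isPostLog = false → (L.lam v ν ⋙ L.forget v ⋙ L.toE v ≅ L.proj))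
  (Ξ : L.log ⋙ L.proj ≅ L.proj)

/-- The structure functor at a holomorphic vertex: the natural projection to `ℰ• = Th•[Z]` followed by the fully faithful
`T := κ_{An•} ⋙ κ₂ : ℰ• → An•[𝒳] → ℰ•` for the rows `≤ 5`, `κ₂` at `An•[𝒳]`, the identity at the `ℰ•` of row 7.
[cite: MochizukiAbsTopIII2015, Cor 5.5 (i) p. 130] -/
def holN : (x : DVertex Vmod isArc) → x.IsHolomorphic → (x.category L ⥤ L.E)
  | .row1 _, _ => L.proj ⋙ L.κAn.functor ⋙ L.κAn₂.functor
  | .core, _ => L.proj ⋙ L.κAn.functor ⋙ L.κAn₂.functor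
  | .nplus v, _ => (L.forget v ⋙ L.toE v) ⋙ L.κAn.functor ⋙ L.κAn₂.functor
  | .nv v, _ => L.toE v ⋙ L.κAn.functor ⋙ L.κAn₂.functor
  | .e5, _ => L.κAn.functor ⋙ L.κAn₂.functor
  | .an, _ => L.κAn₂.functor
  | .e7, _ => 𝟭 L.E
  | .nmonoPlus _, h => False.elim h
  | .nmono _, h => False.elim h
  | .emono5, h => False.elim h
  | .anMono, h => False.elim h
  | .emono7, h => False.elim h

/-- Every arrow of `D•` lies over `ℰ•` through these structure functors, by an isomorphism assembled from the data `Ξ`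
(for `log`), `A` (for `λ⊞_{v,ν}`) and associators/unitors. [cite: MochizukiAbsTopIII2015, Cor 5.5 (i) p. 130] -/
def holμ : ∀ {a b : DVertex Vmod isArc} (e : DEdge isArc a b) (ha : a.IsHolomorphic) (hb : b.IsHolomorphic),
    (DEdge.functor L e ⋙ L.holN b hb ≅ L.holN a ha)
  | _, _, .log _, _, _ =>
    (Functor.associator _ _ _).symm ≪≫ Functor.isoWhiskerRight Ξ (L.κAn.functor ⋙ L.κAn₂.functor)
  | _, _, .toCore _, _, _ => Functor.leftUnitor _
  | _, _, .lam v ν hν, _, _ =>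
    (Functor.associator _ _ _).symm ≪≫ Functor.isoWhiskerRight (A v ν hν) (L.κAn.functor ⋙ L.κAn₂.functor)
  | _, _, .forget _, _, _ => (Functor.associator _ _ _).symm
  | _, _, .toE _, _, _ => Iso.refl _
  | _, _, .κAn, _, _ => Iso.refl _
  | _, _, .anToE, _, _ => Functor.rightUnitor _
  | _, _, .monoNplus _, _, hb => False.elim hb
  | _, _, .monoN _, _, hb => False.elim hb
  | _, _, .monoE5, _, hb => False.elim hb
  | _, _, .monoAn, _, hb => False.elim hb
  | _, _, .monoE7, _, hb => False.elim hb
  | _, _, .forgetMono _, _, hb => False.elim hb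
  | _, _, .toEmono _, _, hb => False.elim hb
  | _, _, .κAnMono, _, hb => False.elim hb
  | _, _, .anMonoToE, _, hb => False.elim hb

/-- **The structure functors of the holomorphic sub-diagram `D•` over `ℰ•`** (abc-iut-L4-t12's `OverData`) determined
by the over-data `A`, `Ξ`. [cite: MochizukiAbsTopIII2015, Remark 3.5.1 p.78] -/
def holOverData : (L.subdiagram DVertex.IsHolomorphic).OverData L.E where
  N a := L.holN a.1 a.2
  μ e := L.holμ A Ξ e _ _

/-- `T = κ_{An•} ⋙ κ₂` is fully faithful (both are equivalences). [cite: MochizukiAbsTopIII2015, Cor 5.2 (iv) p. 120] -/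
noncomputable def fullyFaithfulT : (L.κAn.functor ⋙ L.κAn₂.functor).FullyFaithful :=
  L.κAn.fullyFaithfulFunctor.comp L.κAn₂.fullyFaithfulFunctor

/-- The three core vertices `ℰ•` (row 5), `An•[𝒳]`, `ℰ•` (row 7). [cite: MochizukiAbsTopIII2015, Cor 5.5 (i) p. 130] -/
def IsCoreVertex : DVertex Vmod isArc → Prop
  | .e5 | .an | .e7 => True
  | _ => False

/-- Core vertices are holomorphic. [cite: MochizukiAbsTopIII2015, Cor 5.5 (i) p. 130] -/
theorem isHolomorphic_of_isCoreVertex {x : DVertex Vmod isArc} (hx : IsCoreVertex x) : x.IsHolomorphic := by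
  cases x <;> trivial

/-- At a core vertex the structure functor is fully faithful. [cite: MochizukiAbsTopIII2015, Cor 5.5 (i) p. 130] -/
noncomputable def holN_fullyFaithful : (x : DVertex Vmod isArc) → (hx : IsCoreVertex x) →
    (L.holN x (isHolomorphic_of_isCoreVertex hx)).FullyFaithful
  | .e5, _ => L.fullyFaithfulT
  | .an, _ => L.κAn₂.fullyFaithfulFunctor
  | .e7, _ => Functor.FullyFaithful.id L.E
  | .row1 _, h => False.elim h
  | .core, h => False.elim h
  | .nplus _, h => False.elim h
  | .nv _, h => False.elim h
  | .nmonoPlus _, h => False.elim h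
  | .nmono _, h => False.elim h
  | .emono5, h => False.elim h
  | .anMono, h => False.elim h
  | .emono7, h => False.elim h

/-! ## Bookkeeping: conjugation by `eqToHom` -/

section Conj

variable {C : Type*} [Category C]

/-- Conjugating an identity by `eqToHom`s gives an identity. [folklore] -/
private theorem conj_id {X Y : C} (h : X = Y) : eqToHom h ≫ 𝟙 Y ≫ eqToHom h.symm = 𝟙 X := by
  cases h
  simp

/-- Composite of two `eqToHom`-conjugates with matching middle. [folklore] -/
private theorem conj_comp_conj {X X' Y Y' Z Z' : C} (hX : X = X') (hY : Y = Y') (hZ : Z = Z') (f : X' ⟶ Y')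
    (g : Y' ⟶ Z') :
    (eqToHom hX ≫ f ≫ eqToHom hY.symm) ≫ (eqToHom hY ≫ g ≫ eqToHom hZ.symm) =
      eqToHom hX ≫ (f ≫ g) ≫ eqToHom hZ.symm := by
  cases hX; cases hY; cases hZ
  simp

/-- A functor applied to a component of an `eqToHom`-conjugated natural transformation is, heterogeneously, the functor
applied to the component. [folklore] -/
private theorem map_app_conj_heq {A₁ B₁ : Type*} [Category A₁] [Category B₁] (N : B₁ ⥤ C) {F F' G G' : A₁ ⥤ B₁}
    (hF : F = F') (hG : G = G') (l : F' ⟶ G') (x : A₁) :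
    N.map ((eqToHom hF ≫ l ≫ eqToHom hG.symm).app x) ≍ N.map (l.app x) := by
  cases hF; cases hG
  simp

/-- Conversely, an `eqToHom`-conjugate is recovered from a heterogeneous equality of mapped components. [folklore] -/
private theorem map_app_conj_eq_of_heq {A₁ B₁ : Type*} [Category A₁] [Category B₁] (N : B₁ ⥤ C) {F F' G G' : A₁ ⥤ B₁}
    (hF : F' = F) (hG : G' = G) (θ : F' ⟶ G') (x : A₁) (f : N.obj (F.obj x) ⟶ N.obj (G.obj x))
    (h : N.map (θ.app x) ≍ f) : N.map ((eqToHom hF.symm ≫ θ ≫ eqToHom hG).app x) = f := by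
  cases hF; cases hG
  simp only [eqToHom_refl, Category.comp_id, Category.id_comp]
  exact eq_of_heq h

end Conj

/-! ## The induced homotopies between co-verticial paths of `Γ⃗_{D•⊢}` into a core vertex -/

/-- the lift of a path with holomorphic target into the holomorphic sub-diagram. [cite: MochizukiAbsTopIII2015, Cor 5.5 p. 130] -/
abbrev holLift {a b : DVertex Vmod isArc} (p : Path a b) (hb : b.IsHolomorphic) :
    Path (V := DSub (DVertex.IsHolomorphic (isArc := isArc)))
      ⟨a, DSub.mem_of_path DVertex.isHolomorphic_of_hom p hb⟩ ⟨b, hb⟩ :=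
  DSub.liftPath DVertex.isHolomorphic_of_hom p hb

/-- The path functor of a path is the path functor of its lift. [cite: MochizukiAbsTopIII2015, Definition 3.5 (i) p.75] -/
theorem pathFunctor_eq_holLift {a b : DVertex Vmod isArc} (p : Path a b) (hb : b.IsHolomorphic) :
    L.diagram.pathFunctor p = (L.subdiagram DVertex.IsHolomorphic).pathFunctor (holLift p hb) :=
  (L.pathFunctor_liftPath DVertex.isHolomorphic_of_hom p hb).symm

/-- **The homotopy between two co-verticial paths of `Γ⃗_{D•⊢}` into a core vertex** determined by the over-data: the
unique natural transformation lying over `pathIso p ∘ (pathIso q)⁻¹` through the fully faithful structure functor at the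
core vertex (abc-iut-L4-t5's `OverData.lift`, transported from the holomorphic sub-diagram).
[cite: MochizukiAbsTopIII2015, Remark 3.5.1 p.78] -/
noncomputable def coreLift {a w : DVertex Vmod isArc} (hw : IsCoreVertex w) (p q : Path a w) :
    L.diagram.pathFunctor p ⟶ L.diagram.pathFunctor q :=
  eqToHom (L.pathFunctor_eq_holLift p (isHolomorphic_of_isCoreVertex hw)) ≫
    (L.holOverData A Ξ).lift (w := ⟨w, isHolomorphic_of_isCoreVertex hw⟩) (L.holN_fullyFaithful w hw)
      (holLift p _) (holLift q _) ≫
      eqToHom (L.pathFunctor_eq_holLift q (isHolomorphic_of_isCoreVertex hw)).symm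

/-- `coreLift` is, heterogeneously, the lift in the sub-diagram. [cite: MochizukiAbsTopIII2015, Remark 3.5.1 p.78] -/
theorem coreLift_heq_lift {a w : DVertex Vmod isArc} (hw : IsCoreVertex w) (p q : Path a w) :
    L.coreLift A Ξ hw p q ≍ (L.holOverData A Ξ).lift (w := ⟨w, isHolomorphic_of_isCoreVertex hw⟩)
      (L.holN_fullyFaithful w hw) (holLift p _) (holLift q _) :=
  DiagramOfCategories.HomotopyFamily.heq_eqToHom_comp_comp_eqToHom _ _ _

/-- Axiom "`ζ_{([γ],[γ])}` is the identity" of Def 3.5 (ii). [cite: MochizukiAbsTopIII2015, Definition 3.5 (ii) p.75] -/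
theorem coreLift_self {a w : DVertex Vmod isArc} (hw : IsCoreVertex w) (p : Path a w) :
    L.coreLift A Ξ hw p p = 𝟙 _ := by
  unfold coreLift
  exact (congrArg (fun l => eqToHom _ ≫ l ≫ eqToHom _)
    ((L.holOverData A Ξ).lift_self (w := ⟨w, isHolomorphic_of_isCoreVertex hw⟩) (L.holN_fullyFaithful w hw)
      (holLift p _))).trans (conj_id _)

/-- Axiom "`ζ_{ϖ''} = ζ_{ϖ'} ∘ ζ_ϖ`" of Def 3.5 (ii). [cite: MochizukiAbsTopIII2015, Definition 3.5 (ii) p.75] -/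
theorem coreLift_trans {a w : DVertex Vmod isArc} (hw : IsCoreVertex w) (p q r : Path a w) :
    L.coreLift A Ξ hw p q ≫ L.coreLift A Ξ hw q r = L.coreLift A Ξ hw p r := by
  have hwh := isHolomorphic_of_isCoreVertex hw
  unfold coreLift
  exact (conj_comp_conj (L.pathFunctor_eq_holLift p hwh) (L.pathFunctor_eq_holLift q hwh)
    (L.pathFunctor_eq_holLift r hwh) _ _).trans (congrArg
      (fun l => eqToHom (L.pathFunctor_eq_holLift p hwh) ≫ l ≫ eqToHom (L.pathFunctor_eq_holLift r hwh).symm)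
    ((L.holOverData A Ξ).lift_trans (w := ⟨w, hwh⟩) (L.holN_fullyFaithful w hw)
      (holLift p _) (holLift q _) (holLift r _)))

/-- Lifts at equal pairs of lifted paths agree heterogeneously (bookkeeping). [folklore] -/
private theorem lift_congr_heq {C : Type (u + 1)} [Category.{u} C]
    (O : (L.subdiagram DVertex.IsHolomorphic).OverData C) {a w : DSub (DVertex.IsHolomorphic (isArc := isArc))}
    (hff : (O.N w).FullyFaithful) {p p' q q' : Path a w} (hp : p = p') (hq : q = q') :
    O.lift hff p q ≍ O.lift hff p' q' := by
  subst hp hq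
  rfl

/-- Whiskering on the left respects heterogeneous equality (bookkeeping). [folklore] -/
private theorem whiskerLeft_heq {A' A₁ B : Type (u + 1)} [Category.{u} A'] [Category.{u} A₁] [Category.{u} B]
    {R R' : A' ⥤ A₁} (hR : R = R') {F G F' G' : A₁ ⥤ B} (hF : F = F') (hG : G = G') {α : F ⟶ G} {α' : F' ⟶ G'}
    (h : α ≍ α') : Functor.whiskerLeft R α ≍ Functor.whiskerLeft R' α' := by
  subst hR hF hG
  cases h
  rfl

/-- Whiskering on the right respects heterogeneous equality (bookkeeping). [folklore] -/
private theorem whiskerRight_heq {A₁ B B' : Type (u + 1)} [Category.{u} A₁] [Category.{u} B] [Category.{u} B']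
    {F G F' G' : A₁ ⥤ B} (hF : F = F') (hG : G = G') {α : F ⟶ G} {α' : F' ⟶ G'} (h : α ≍ α') {T T' : B ⥤ B'}
    (hT : T = T') : Functor.whiskerRight α T ≍ Functor.whiskerRight α' T' := by
  subst hF hG hT
  cases h
  rfl

/-- Pre-composition half of the whiskering axiom of Def 3.5 (ii): `coreLift (γ₁∘ρ) (γ₂∘ρ) = D•⊢_[ρ] ◁ coreLift γ₁ γ₂`,
heterogeneously. [cite: MochizukiAbsTopIII2015, Definition 3.5 (ii) p.75] -/
theorem coreLift_precomp_heq {c a w : DVertex Vmod isArc} (hw : IsCoreVertex w) (r : Path c a) (p q : Path a w) :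
    L.coreLift A Ξ hw (r.comp p) (r.comp q) ≍ Functor.whiskerLeft (L.diagram.pathFunctor r) (L.coreLift A Ξ hw p q) := by
  have hwh := isHolomorphic_of_isCoreVertex hw
  refine (L.coreLift_heq_lift A Ξ hw _ _).trans ?_
  refine (L.lift_congr_heq (L.holOverData A Ξ) (w := ⟨w, hwh⟩) (L.holN_fullyFaithful w hw)
    (DSub.liftPath_comp DVertex.isHolomorphic_of_hom r p hwh)
    (DSub.liftPath_comp DVertex.isHolomorphic_of_hom r q hwh)).trans ?_
  refine ((L.holOverData A Ξ).lift_precomp_heq (w := ⟨w, hwh⟩) (L.holN_fullyFaithful w hw) _ _ _).trans ?_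
  exact whiskerLeft_heq (L.pathFunctor_eq_holLift r _).symm (L.pathFunctor_eq_holLift p hwh).symm
    (L.pathFunctor_eq_holLift q hwh).symm (L.coreLift_heq_lift A Ξ hw p q).symm

/-- Post-composition half of the whiskering axiom of Def 3.5 (ii), between two core vertices:
`coreLift (τ∘γ₁) (τ∘γ₂) = coreLift γ₁ γ₂ ▷ D•⊢_[τ]`, heterogeneously. [cite: MochizukiAbsTopIII2015, Definition 3.5 (ii) p.75] -/
theorem coreLift_postcomp_heq {a w w' : DVertex Vmod isArc} (hw : IsCoreVertex w) (hw' : IsCoreVertex w')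
    (p q : Path a w) (t : Path w w') :
    L.coreLift A Ξ hw' (p.comp t) (q.comp t) ≍ Functor.whiskerRight (L.coreLift A Ξ hw p q) (L.diagram.pathFunctor t) := by
  have hwh := isHolomorphic_of_isCoreVertex hw
  have hwh' := isHolomorphic_of_isCoreVertex hw'
  refine (L.coreLift_heq_lift A Ξ hw' _ _).trans ?_
  refine (L.lift_congr_heq (L.holOverData A Ξ) (w := ⟨w', hwh'⟩) (L.holN_fullyFaithful w' hw')
    (DSub.liftPath_comp DVertex.isHolomorphic_of_hom p t hwh')
    (DSub.liftPath_comp DVertex.isHolomorphic_of_hom q t hwh')).trans ?_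
  refine ((L.holOverData A Ξ).lift_postcomp_heq (w := ⟨w, hwh⟩) (w' := ⟨w', hwh'⟩) (L.holN_fullyFaithful w hw)
    (L.holN_fullyFaithful w' hw') _ _ _).trans ?_
  exact whiskerRight_heq (L.pathFunctor_eq_holLift p hwh).symm (L.pathFunctor_eq_holLift q hwh).symm
    (L.coreLift_heq_lift A Ξ hw p q).symm (L.pathFunctor_eq_holLift t hwh').symm

/-- **`coreLift` lies over `pathIso p ∘ (pathIso q)⁻¹`, componentwise** — the defining property, through the structure
functor at the core vertex (heterogeneously: the two sides live over definitionally, not syntactically, equal objects).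
[cite: MochizukiAbsTopIII2015, Definition 3.5 (ii) p.75] -/
theorem map_coreLift_app_heq {a w : DVertex Vmod isArc} (hw : IsCoreVertex w) (p q : Path a w)
    (x : L.diagram.obj a) :
    (L.holN w (isHolomorphic_of_isCoreVertex hw)).map ((L.coreLift A Ξ hw p q).app x) ≍
      ((L.holOverData A Ξ).pathIso (holLift p (isHolomorphic_of_isCoreVertex hw))).hom.app x ≫
        ((L.holOverData A Ξ).pathIso (holLift q (isHolomorphic_of_isCoreVertex hw))).inv.app x := by
  have hwh := isHolomorphic_of_isCoreVertex hw
  have key := (L.holOverData A Ξ).map_lift_app (w := ⟨w, hwh⟩) (L.holN_fullyFaithful w hw) (holLift p hwh)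
    (holLift q hwh) x
  unfold coreLift
  exact (map_app_conj_heq (L.holN w hwh) (L.pathFunctor_eq_holLift p hwh) (L.pathFunctor_eq_holLift q hwh) _ x).trans
    (heq_of_eq key)

/-- Uniqueness: a natural transformation `D•⊢_[p] ⟶ D•⊢_[q]` lying over `pathIso p ∘ (pathIso q)⁻¹` (heterogeneously, as
above) IS `coreLift p q` — faithfulness of the structure functor. [cite: MochizukiAbsTopIII2015, Definition 3.5 (ii) p.75] -/
theorem coreLift_ext {a w : DVertex Vmod isArc} (hw : IsCoreVertex w) {p q : Path a w}
    (θ : L.diagram.pathFunctor p ⟶ L.diagram.pathFunctor q)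
    (hθ : ∀ x : L.diagram.obj a, (L.holN w (isHolomorphic_of_isCoreVertex hw)).map (θ.app x) ≍
      ((L.holOverData A Ξ).pathIso (holLift p (isHolomorphic_of_isCoreVertex hw))).hom.app x ≫
        ((L.holOverData A Ξ).pathIso (holLift q (isHolomorphic_of_isCoreVertex hw))).inv.app x) :
    θ = L.coreLift A Ξ hw p q := by
  have hwh := isHolomorphic_of_isCoreVertex hw
  -- transport `θ` to the sub-diagram and use uniqueness of the lift there
  have hθ' : eqToHom (L.pathFunctor_eq_holLift p hwh).symm ≫ θ ≫ eqToHom (L.pathFunctor_eq_holLift q hwh) =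
      (L.holOverData A Ξ).lift (w := ⟨w, hwh⟩) (L.holN_fullyFaithful w hw) (holLift p hwh) (holLift q hwh) := by
    refine (L.holOverData A Ξ).lift_ext (w := ⟨w, hwh⟩) (L.holN_fullyFaithful w hw) _ fun x => ?_
    exact map_app_conj_eq_of_heq ((L.holOverData A Ξ).N ⟨w, hwh⟩) (L.pathFunctor_eq_holLift p hwh)
      (L.pathFunctor_eq_holLift q hwh) θ x _ (hθ x)
  unfold coreLift
  rw [← hθ']
  simp only [Category.assoc, eqToHom_trans, eqToHom_refl, Category.comp_id, eqToHom_trans_assoc, Category.id_comp]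

end OverE

end LogFrobeniusSetting

end Literature.AnabelianGeometry.AbsoluteAnabelian
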